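import Literature.Analysis.PDE.TorusWordCalculus
import HarnessLib

/-!
# Sup bounds for word derivatives `σ` orders below the energy level (generic margin)

The `σ`-margin versions of `Literature.Analysis.PDE.norm_sq_iterPartialDeriv_le_twordEnergy`,
`….norm_sq_cwd_lift_le_twordEnergy` and `….norm_cwd_lift_le_sqrt` (there the margin is the literal
`2` of `H²(𝕋³) ⊂ L^∞`): given a word-form sup-embedding constant `C_s` at margin `σ`
(`‖f x‖² ≤ C_s · twordEnergy σ f` for all smooth `f`, e.g. from
`Literature.Analysis.FunctionSpaces.Torus.WordSupEmbedding ι σ`), every word derivative `∂^c f`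
with `|c| + σ ≤ m` is bounded pointwise by `C_s · twordEnergy m f` (Majda 1984, Ch. 2 §2.1, the
Sobolev calculus inequalities behind Prop. 2.2). Everything is proved; no definitions.

## Mathlib / tree search

Searched the tree for `norm_sq_iterPartialDeriv_le_twordEnergy`, `norm_cwd_lift_le_sqrt`,
`twordEnergy_iterPartialDeriv_le` (`TorusWordCalculus`, margin `2` only); Mathlib has no torus
Sobolev calculus (`twordEnergy`, `iterPartialDeriv` are tree notions).

## References

* A. Majda, *Compressible Fluid Flow and Systems of Conservation Laws in Several Space
  Variables* (Springer 1984), Ch. 2 §2.1. [Majda1984]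
-/

noncomputable section

open MeasureTheory Set Function

namespace Literature.Analysis.PDE

open Literature.Analysis.FunctionSpaces Literature.Analysis.FunctionSpaces.Torus

variable {ι : Type*} [Fintype ι] [DecidableEq ι]
variable {F' : Type*} [NormedAddCommGroup F'] [NormedSpace ℝ F']

/-- **Sup bound for word derivatives `σ` orders below the energy level**: given the word-form
embedding constant `C_s` at margin `σ`, `‖∂^c f (x)‖² ≤ C_s · twordEnergy m f` whenever
`|c| + σ ≤ m`. [cite: Majda1984, Ch. 2 §2.1] -/
theorem norm_sq_iterPartialDeriv_le_twordEnergy_of_margin {Cs : ℝ} {σ : ℕ}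
    (hCs : ∀ f : UnitAddTorus ι → F', IsSmooth f → ∀ x, ‖f x‖ ^ 2 ≤ Cs * twordEnergy σ f)
    (hCs0 : 0 ≤ Cs) {f : UnitAddTorus ι → F'} (hf : IsSmooth f) {c : List ι} {m : ℕ}
    (hc : c.length + σ ≤ m) (x : UnitAddTorus ι) :
    ‖iterPartialDeriv c f x‖ ^ 2 ≤ Cs * twordEnergy m f :=
  (hCs _ (hf.iterPartialDeriv c) x).trans
    (mul_le_mul_of_nonneg_left (twordEnergy_iterPartialDeriv_le (by omega) f) hCs0)

/-- The same for the lifted derivatives, at every point of `ℝⁿ`. [cite: Majda1984, Ch. 2 §2.1] -/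
theorem norm_sq_cwd_lift_le_twordEnergy_of_margin {Cs : ℝ} {σ : ℕ}
    (hCs : ∀ f : UnitAddTorus ι → F', IsSmooth f → ∀ x, ‖f x‖ ^ 2 ≤ Cs * twordEnergy σ f)
    (hCs0 : 0 ≤ Cs) {f : UnitAddTorus ι → F'} (hf : IsSmooth f) {c : List ι} {m : ℕ}
    (hc : c.length + σ ≤ m) (y : EuclideanSpace ℝ ι) :
    ‖cwd c (lift f) y‖ ^ 2 ≤ Cs * twordEnergy m f := by
  rw [← iterPartialDeriv_apply_proj hf]
  exact norm_sq_iterPartialDeriv_le_twordEnergy_of_margin hCs hCs0 hf hc _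

/-- Norm form: `‖cwd c (lift f) y‖ ≤ √(C_s · twordEnergy m f)` for `|c| + σ ≤ m`.
[cite: Majda1984, Ch. 2 §2.1] -/
theorem norm_cwd_lift_le_sqrt_of_margin {Cs : ℝ} {σ : ℕ}
    (hCs : ∀ f : UnitAddTorus ι → F', IsSmooth f → ∀ x, ‖f x‖ ^ 2 ≤ Cs * twordEnergy σ f)
    (hCs0 : 0 ≤ Cs) {f : UnitAddTorus ι → F'} (hf : IsSmooth f) {c : List ι} {m : ℕ}
    (hc : c.length + σ ≤ m) (y : EuclideanSpace ℝ ι) :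
    ‖cwd c (lift f) y‖ ≤ √(Cs * twordEnergy m f) := by
  rw [← Real.sqrt_sq (norm_nonneg _)]
  exact Real.sqrt_le_sqrt (norm_sq_cwd_lift_le_twordEnergy_of_margin hCs hCs0 hf hc y)

end Literature.Analysis.PDE

end
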